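import Literature.AlgebraicGeometry.Morphisms.CofanPieceMap
import HarnessLib

/-!
# Piece maps for a FAMILY of morphisms between coproducts, and for composites

Topic: `Literature/AlgebraicGeometry/Morphisms`.  PROOF FILE (theorems only; no definition, no named fact); corollary layer of ★
`CofanPieceMap` (p759656).  Setting: a COLIMIT cofan `(f_i : X_i ⟶ S)_{i ∈ σ}` in `Over B`, a family `(f'_j : X'_j ⟶ S')_{j ∈ σ'}` of
`B`-morphisms from non-empty preconnected `B`-schemes, and now a FAMILY of morphisms `T_a : S' ⟶ S` (`a ∈ ι`) — the Hecke
translates `T_γ : X_N → X_K` (`γ` in a transversal of `KgK/K`), the level projections `u = T_1`, and the deck translates `T_δ` of a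
tower of (Shimura) curves, read on the complex fibres, which are coproducts of geometrically irreducible pieces.

* `Over.exists_pieceMap_family` (+ `_of_irreducibleSpace`) — index maps `φ_a : σ' → σ` and lifts `t_{a,j} : X'_j ⟶ X_{φ_a j}` with
  `t_{a,j} ≫ f_{φ_a j} = f'_j ≫ T_a` for ALL `a` at once (★ `Over.exists_pieceMap_of_isColimit_cofan` per `a`, assembled by choice) — the
  data package `(φ, tp, htp)` consumed by ★ `Albanese.inj_comp_map_baseChange_eq_pushforward_comp_inj` / ★ `albTr_baseChange_word` /
  ★ `HeckeEndomorphismTransposedWord`.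
* `Over.pieceMap_comp_fac` — piece maps compose: lifts for `T₁ : S'' ⟶ S'` and `T₂ : S' ⟶ S` give lifts for `T₁ ≫ T₂` with index map
  `φ₂ ∘ φ₁`; `Over.pieceMap_index_eq_comp`, `Over.pieceMap_eq_comp` — and ANY piece-map system of `T₁ ≫ T₂` has this index map and
  these lifts (★ uniqueness) — the «endpoints agree» bookkeeping when a translate is factored through a deeper level
  (`T_{γ⁻¹}^{N″→K} = q′ ≫ u`, `u″ = q′ ≫ T_γ`).
* `Over.pieceMap_index_eq_of_eq`, `Over.pieceMap_eq_of_eq` — two morphisms `T = T'` have the same piece indices and lifts.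

[cite: GortzWedhorn2020, Lemma 1.19 (1) (§(1.5)) with §(3.5) Proposition 3.10 and Example 3.11 (p. 73)]

Mathlib searched: `Classical.choice`/`choose` only; no statement about morphisms between coproducts of schemes (as for ★ p759656).
-/

set_option autoImplicit false

noncomputable section

open CategoryTheory CategoryTheory.Limits AlgebraicGeometry Set Function

namespace Literature.AlgebraicGeometry.Morphisms

universe v u

variable {σ : Type v} [Small.{u} σ] {B : Scheme.{u}} {X : σ → Over B} {S : Over B} {f : ∀ i, X i ⟶ S}
  {σ' : Type*} {X' : σ' → Over B} {S' : Over B}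

/-! ## §1 A family of morphisms -/

/-- **Piece maps for a family of morphisms at once.**  For a colimit cofan `(f_i : X_i ⟶ S)` in `Over B`, a family
`f'_j : X'_j ⟶ S'` from non-empty preconnected `B`-schemes and morphisms `T_a : S' ⟶ S` (`a ∈ ι`), there are index maps
`φ_a : σ' → σ` and lifts `t_{a,j} : X'_j ⟶ X_{φ_a j}` with `t_{a,j} ≫ f_{φ_a j} = f'_j ≫ T_a` (★ `Over.exists_pieceMap_of_isColimit_cofan`
for each `a`, assembled by choice). [cite: GortzWedhorn2020, Lemma 1.19 (1) (§(1.5)) with §(3.5) Example 3.11 (p. 73)] -/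
theorem Over.exists_pieceMap_family (hc : IsColimit (Cofan.mk S f)) (f' : ∀ j, X' j ⟶ S')
    [∀ j, PreconnectedSpace (X' j).left] [∀ j, Nonempty (X' j).left] {ι : Type*} (T : ι → (S' ⟶ S)) :
    ∃ (φ : ι → σ' → σ) (t : ∀ a j, X' j ⟶ X (φ a j)), ∀ a j, t a j ≫ f (φ a j) = f' j ≫ T a := by
  have h : ∀ a, ∃ (φ : σ' → σ) (t : ∀ j, X' j ⟶ X (φ j)), ∀ j, t j ≫ f (φ j) = f' j ≫ T a := fun a =>
    Over.exists_pieceMap_of_isColimit_cofan hc f' (T a)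
  choose φ t ht using h
  exact ⟨φ, t, ht⟩

/-- **The same for irreducible pieces** (an irreducible space is non-empty and preconnected — e.g. the geometrically irreducible
pieces of the complex fibre of a curve). [cite: GortzWedhorn2020, Lemma 1.19 (1) (§(1.5)) with §(3.5) Example 3.11 (p. 73)] -/
theorem Over.exists_pieceMap_family_of_irreducibleSpace (hc : IsColimit (Cofan.mk S f)) (f' : ∀ j, X' j ⟶ S')
    [∀ j, IrreducibleSpace (X' j).left] {ι : Type*} (T : ι → (S' ⟶ S)) :
    ∃ (φ : ι → σ' → σ) (t : ∀ a j, X' j ⟶ X (φ a j)), ∀ a j, t a j ≫ f (φ a j) = f' j ≫ T a :=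
  haveI : ∀ j, Nonempty (X' j).left := fun _ => IrreducibleSpace.toNonempty
  Over.exists_pieceMap_family hc f' T

/-! ## §2 Equal morphisms, composite morphisms -/

/-- **Equal morphisms hit the same pieces**: piece-map systems for `T` and for `T'` with `T = T'` have the same index at every
non-empty piece (★ `Over.pieceMap_index_unique`). [cite: GortzWedhorn2020, §(3.5) Proposition 3.10 and Example 3.11 (p. 73)] -/
theorem Over.pieceMap_index_eq_of_eq (hc : IsColimit (Cofan.mk S f)) {f' : ∀ j, X' j ⟶ S'} {T T' : S' ⟶ S} (hT : T = T')
    {j : σ'} [Nonempty (X' j).left] {i i' : σ} (t : X' j ⟶ X i) (t' : X' j ⟶ X i') (h : t ≫ f i = f' j ≫ T)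
    (h' : t' ≫ f i' = f' j ≫ T') : i = i' := by
  subst hT
  exact Over.pieceMap_index_unique hc t t' h h'

/-- **Equal morphisms have the same lifts** into a given piece (★ `Over.pieceMap_unique`).
[cite: GortzWedhorn2020, §(3.5) Proposition 3.10 and Example 3.11 (p. 73)] -/
theorem Over.pieceMap_eq_of_eq (hc : IsColimit (Cofan.mk S f)) {f' : ∀ j, X' j ⟶ S'} {T T' : S' ⟶ S} (hT : T = T')
    {j : σ'} {i : σ} (t t' : X' j ⟶ X i) (h : t ≫ f i = f' j ≫ T) (h' : t' ≫ f i = f' j ≫ T') : t = t' := by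
  subst hT
  exact Over.pieceMap_unique hc t t' h h'

variable {σ'' : Type*} {X'' : σ'' → Over B} {S'' : Over B}

omit [Small.{u} σ] in
/-- **Piece maps compose.**  Lifts `t₁` (index map `φ₁`) of `T₁ : S'' ⟶ S'` through the family `f'` and lifts `t₂` (index map `φ₂`) of
`T₂ : S' ⟶ S` through the cofan `f` compose to lifts of `T₁ ≫ T₂` with index map `φ₂ ∘ φ₁`.
[cite: GortzWedhorn2020, Lemma 1.19 (1) (§(1.5)) with §(3.5) Example 3.11 (p. 73)] -/
theorem Over.pieceMap_comp_fac {f'' : ∀ k, X'' k ⟶ S''} {f' : ∀ j, X' j ⟶ S'} {T₁ : S'' ⟶ S'} {T₂ : S' ⟶ S}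
    {φ₁ : σ'' → σ'} (t₁ : ∀ k, X'' k ⟶ X' (φ₁ k)) (h₁ : ∀ k, t₁ k ≫ f' (φ₁ k) = f'' k ≫ T₁)
    {φ₂ : σ' → σ} (t₂ : ∀ j, X' j ⟶ X (φ₂ j)) (h₂ : ∀ j, t₂ j ≫ f (φ₂ j) = f' j ≫ T₂) (k : σ'') :
    (t₁ k ≫ t₂ (φ₁ k)) ≫ f (φ₂ (φ₁ k)) = f'' k ≫ (T₁ ≫ T₂) := by
  rw [Category.assoc, h₂, ← Category.assoc, h₁, Category.assoc]

/-- **Any piece-map system of a composite has the composite index map**: if `(φ, t)` are lifts of `T₁ ≫ T₂` through the colimit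
cofan `f`, then `φ k = φ₂ (φ₁ k)` at every non-empty piece (★ `Over.pieceMap_index_unique` against `Over.pieceMap_comp_fac`) —
e.g. the piece of `X_K` under a piece of `X_{N″}` along `u″ = q′ ≫ T_γ` is the `T_γ`-image of its `q′`-image.
[cite: GortzWedhorn2020, §(3.5) Proposition 3.10 and Example 3.11 (p. 73)] -/
theorem Over.pieceMap_index_eq_comp (hc : IsColimit (Cofan.mk S f)) {f'' : ∀ k, X'' k ⟶ S''} {f' : ∀ j, X' j ⟶ S'}
    {T₁ : S'' ⟶ S'} {T₂ : S' ⟶ S} {φ₁ : σ'' → σ'} (t₁ : ∀ k, X'' k ⟶ X' (φ₁ k)) (h₁ : ∀ k, t₁ k ≫ f' (φ₁ k) = f'' k ≫ T₁)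
    {φ₂ : σ' → σ} (t₂ : ∀ j, X' j ⟶ X (φ₂ j)) (h₂ : ∀ j, t₂ j ≫ f (φ₂ j) = f' j ≫ T₂)
    {k : σ''} [Nonempty (X'' k).left] {i : σ} (t : X'' k ⟶ X i) (h : t ≫ f i = f'' k ≫ (T₁ ≫ T₂)) : i = φ₂ (φ₁ k) :=
  Over.pieceMap_index_unique hc t _ h (Over.pieceMap_comp_fac t₁ h₁ t₂ h₂ k)

/-- **… and the composite lifts**: a lift of `T₁ ≫ T₂` into the piece `X_{φ₂ (φ₁ k)}` IS `t₁ k ≫ t₂ (φ₁ k)` (★ `Over.pieceMap_unique`).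
[cite: GortzWedhorn2020, §(3.5) Proposition 3.10 and Example 3.11 (p. 73)] -/
theorem Over.pieceMap_eq_comp (hc : IsColimit (Cofan.mk S f)) {f'' : ∀ k, X'' k ⟶ S''} {f' : ∀ j, X' j ⟶ S'}
    {T₁ : S'' ⟶ S'} {T₂ : S' ⟶ S} {φ₁ : σ'' → σ'} (t₁ : ∀ k, X'' k ⟶ X' (φ₁ k)) (h₁ : ∀ k, t₁ k ≫ f' (φ₁ k) = f'' k ≫ T₁)
    {φ₂ : σ' → σ} (t₂ : ∀ j, X' j ⟶ X (φ₂ j)) (h₂ : ∀ j, t₂ j ≫ f (φ₂ j) = f' j ≫ T₂)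
    (k : σ'') (t : X'' k ⟶ X (φ₂ (φ₁ k))) (h : t ≫ f (φ₂ (φ₁ k)) = f'' k ≫ (T₁ ≫ T₂)) : t = t₁ k ≫ t₂ (φ₁ k) :=
  Over.pieceMap_unique hc t _ h (Over.pieceMap_comp_fac t₁ h₁ t₂ h₂ k)

/-- **The identity hits the same piece**: a lift of `𝟙 S` from a non-empty LEG `f_j` of the cofan lands in the piece `j` itself
(★ `Over.pieceMap_index_unique` against `𝟙 ≫ f_j = f_j ≫ 𝟙`). [cite: GortzWedhorn2020, §(3.5) Proposition 3.10 and Example 3.11 (p. 73)] -/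
theorem Over.pieceMap_index_eq_self_of_id (hc : IsColimit (Cofan.mk S f)) {j : σ} [Nonempty (X j).left] {i : σ}
    (t : X j ⟶ X i) (h : t ≫ f i = f j ≫ 𝟙 S) : i = j :=
  Over.pieceMap_index_unique hc (f' := f) t (𝟙 (X j)) h (by rw [Category.id_comp, Category.comp_id])

/-- **… and the lift is the identity.** [cite: GortzWedhorn2020, §(3.5) Proposition 3.10 and Example 3.11 (p. 73)] -/
theorem Over.pieceMap_eq_id_of_id (hc : IsColimit (Cofan.mk S f)) (j : σ) (t : X j ⟶ X j) (h : t ≫ f j = f j ≫ 𝟙 S) :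
    t = 𝟙 (X j) :=
  Over.pieceMap_unique hc (f' := f) t (𝟙 (X j)) h (by rw [Category.id_comp, Category.comp_id])

end Literature.AlgebraicGeometry.Morphisms

end
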